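import Summits.Ventures.YMGap.RobustBall.LoopActionMember
import Summits.Ventures.YMGap.RobustBall.RectangleEdges
import HarnessLib

/-!
# Venture YMGap, track ROBUST-BALL (tier 2) — ALL RECTANGULAR WILSON LOOPS: an explicit infinite-range family in
# the loop-action norm ball, with a hypothesis-free `SU(2)` cell

HONEST FRAMING. WHAT THIS IS: a venture file (cell `pub-ymgap`, track Y2 ROBUST-BALL, seat rb-p1), the worked
INSTANCE of `LoopActionMember.lean`: the family `rectLoop` of ALL rectangular loops of `ℤ^d` — every base point,
every coordinate plane `a < b`, every size `(m+1) × (n+1)` — indexed by `RectIdx d = ZdPlaquette d × ℕ × ℕ`.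
We prove (i) from the edge-set geometry of `RectangleEdges.lean` that the carrier fibres of `rectLoop` are finite
(`finite_fibre_rectLoop`); (ii) THE NORM BOUND `loopNormLE_rectLoop`: couplings `|c_i| ≤ τ ρ^{R+T}` have loop-action norm
`‖c‖_w ≤ P_d · τ · (s/(1−s))²` with `s = 4ρe^{w} < 1` and `P_d` the number of coordinate planes; (iii) CELLS:
`SU(2)`, `d = 4`, `β_W = 1/16`: the action `S_W + ∑_{rectangles} c_i Re tr U_{∂i}/2` has the mass gap for EVERY
coupling family with `|c_i| ≤ 64^{-(R+T)}` (`su2_rectFamily_massGapS_1_16`), and every `N ≥ 2` at 't Hooft `1/64`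
with `|c_i| ≤ ½ · 64^{-(R+T)}` (`suN_rectFamily_massGapS_1_64`); (iv) the family is genuinely INFINITE-RANGE and lies
in NO tier-1 ball (`rectLoop_infiniteRange`, `not_memBallZd_rectFamily`). WHAT IT IS NOT: strong-coupling lattice
statements inside the rows' windows; radii are door artefacts; nothing about the continuum limit or the Clay problem.

References: the norm ball and rows are this track's (`LoopActionMember.lean`, `RowsS.lean`, `RowsSN.lean`);
rectangles `rectWalk` are the tree's (`QuantumLattice/WilsonLoops.lean`).
-/

noncomputable section

open MeasureTheory Filter Function Topology Real SimpleGraph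
open Literature.Probability.LatticeModels
open Literature.Probability.LatticeModels.DobrushinMetric
open Literature.MathematicalPhysics.QuantumLattice
open Literature.MathematicalPhysics.QuantumFieldTheory hiding ZdEdge Site

namespace Summit.Ventures.YMGap.RobustBall

variable {d : ℕ}

/-! ### The family of all rectangles -/

section Family

variable (d) in
/-- Index of based rectangles: a plaquette datum `(x, a < b)` (base point and coordinate plane) and the side
excesses `(m, n)`, standing for the `(m+1) × (n+1)` rectangle based at `x` in the plane `(a, b)`. -/
abbrev RectIdx : Type := ZdPlaquette d × ℕ × ℕ

/-- **The rectangle loop** of index `((x, ⟨(a, b), _⟩), m, n)`: the tree's `rectWalk x a b (m+1) (n+1)`. -/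
def rectLoop (i : RectIdx d) : ZdLoop d :=
  ⟨i.1.1, rectWalk i.1.1 i.1.2.1.1 i.1.2.1.2 (i.2.1 + 1) (i.2.2 + 1)⟩

/-- Unfolding lemma (definitional): the walk of `rectLoop ((x, p), m, n)` is `rectWalk x p.1.1 p.1.2 (m+1) (n+1)`. -/
theorem rectLoop_walk (x : Site d) (p : {p : Fin d × Fin d // p.1 < p.2}) (m n : ℕ) :
    (rectLoop ((x, p), m, n)).walk = rectWalk x p.1.1 p.1.2 (m + 1) (n + 1) := rfl

/-- **The carrier fibres of the rectangle family are finite**: a rectangle with edge set `X` is based at a base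
point of a link of `X` and has sides `≤ |X|`. -/
theorem finite_fibre_rectLoop (X : Finset (ZdEdge d)) :
    {i : RectIdx d | walkEdges (rectLoop i).walk = X}.Finite := by
  classical
  refine (Finset.finite_toSet ((X.image Prod.fst ×ˢ (Finset.univ : Finset {p : Fin d × Fin d // p.1 < p.2})) ×ˢ
    (Finset.range X.card ×ˢ Finset.range X.card))).subset ?_
  rintro ⟨⟨x, p⟩, m, n⟩ hX
  change walkEdges (rectWalk x p.1.1 p.1.2 (m + 1) (n + 1)) = X at hX
  simp only [Finset.coe_product, Finset.coe_univ, Set.mem_prod, Set.mem_univ, and_true, Finset.mem_coe,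
    Finset.mem_image, Finset.mem_range]
  refine ⟨⟨(x, p.1.1), ?_, rfl⟩, ?_, ?_⟩
  · rw [← hX, mem_walkEdges_rectWalk_iff]
    exact Or.inl ⟨0, Nat.succ_pos m, by simp⟩
  · have h := succ_le_card_walkEdges_rectWalk_fst x p.1.1 p.1.2 m (n + 1)
    rw [hX] at h
    omega
  · have h := succ_le_card_walkEdges_rectWalk_snd x p.1.1 p.1.2 (m + 1) n
    rw [hX] at h
    omega

end Family

/-! ### The norm of rectangle couplings -/

section Norm

/-- `2n ≤ 2^n`. -/
theorem two_mul_le_two_pow (n : ℕ) : (2 : ℝ) * n ≤ 2 ^ n := by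
  have h : 2 * n ≤ 2 ^ n := by
    induction n with
    | zero => simp
    | succ k ih =>
      rcases Nat.eq_zero_or_pos k with hk | hk
      · subst hk; simp
      · calc 2 * (k + 1) ≤ 2 * k + 2 * k := by omega
          _ ≤ 2 ^ k + 2 ^ k := add_le_add ih ih
          _ = 2 ^ (k + 1) := by ring
  exact_mod_cast h

variable {w ρ τ : ℝ} {c : RectIdx d → ℝ}

/-- **Per-term bound**: through a link of the rectangle `i` (sides `R = m+1`, `T = n+1`), a coupling with
`|c_i| ≤ τ ρ^{R+T}` weighs at most `τ (2ρe^{w})^{R+T}` (`w ≥ 0`: `|∂i| = 2(R+T) ≤ 2^{R+T}` darts, each within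
distance `R + T`). -/
theorem loopWeightAt_rectLoop_le (hw : 0 ≤ w) (hρ : 0 ≤ ρ) (hτ : 0 ≤ τ)
    (hc : ∀ i : RectIdx d, |c i| ≤ τ * ρ ^ (i.2.1 + i.2.2 + 2)) (e : ZdEdge d) (i : RectIdx d) :
    loopWeightAt w rectLoop c e i ≤
      if e ∈ walkEdges (rectLoop i).walk then τ * (2 * ρ * exp w) ^ (i.2.1 + i.2.2 + 2) else 0 := by
  unfold loopWeightAt
  split_ifs with he
  · set s := i.2.1 + i.2.2 + 2 with hs
    have hRT : ((i.2.1 + 1 : ℕ) : ℝ) + ((i.2.2 + 1 : ℕ) : ℝ) = s := by rw [hs]; push_cast; ring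
    -- each dart within distance `R + T = s`
    have hwt : ∀ y ∈ walkEdges (rectLoop i).walk,
        (dartMult (rectLoop i).walk y : ℝ) * exp (w * ‖e.1 - y.1‖) ≤ (dartMult (rectLoop i).walk y : ℝ) * exp (w * s) := by
      intro y hy
      refine mul_le_mul_of_nonneg_left (exp_le_exp.2 (mul_le_mul_of_nonneg_left ?_ hw)) (Nat.cast_nonneg _)
      rw [← hRT]
      exact norm_sub_le_of_mem_walkEdges_rectWalk (x := i.1.1) (i := i.1.2.1.1) (j := i.1.2.1.2)
        (R := i.2.1 + 1) (T := i.2.2 + 1) he hy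
    have hlen : (rectLoop i).walk.length = 2 * (i.2.1 + 1 + (i.2.2 + 1)) := length_rectWalk _ _ _ _ _
    have hsum : ∑ y ∈ walkEdges (rectLoop i).walk, (dartMult (rectLoop i).walk y : ℝ) * exp (w * ‖e.1 - y.1‖) ≤
        2 ^ s * exp w ^ s := by
      refine (Finset.sum_le_sum hwt).trans ?_
      rw [← Finset.sum_mul, ← Nat.cast_sum, sum_walkEdges_dartMult, hlen, ← Real.exp_nat_mul]
      refine mul_le_mul ?_ (le_of_eq (by rw [mul_comm])) (exp_pos _).le (by positivity)
      have : ((2 * (i.2.1 + 1 + (i.2.2 + 1)) : ℕ) : ℝ) = 2 * (s : ℝ) := by rw [hs]; push_cast; ring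
      rw [this]
      exact two_mul_le_two_pow s
    calc |c i| * ∑ y ∈ walkEdges (rectLoop i).walk, (dartMult (rectLoop i).walk y : ℝ) * exp (w * ‖e.1 - y.1‖)
        ≤ τ * ρ ^ s * (2 ^ s * exp w ^ s) :=
          mul_le_mul (hc i) hsum (Finset.sum_nonneg fun y _ => by positivity) (by positivity)
      _ = τ * (2 * ρ * exp w) ^ s := by rw [mul_pow, mul_pow]; ring
  · exact le_rfl

/-- **Per-shape bound**: for a fixed plane and size, the rectangles through `e` based in any finite set of sites
weigh at most `τ (4ρe^{w})^{R+T}` in total (at most `2(R+T) ≤ 2^{R+T}` of them contain `e`). -/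
theorem sum_loopWeightAt_rectLoop_le (hw : 0 ≤ w) (hρ : 0 ≤ ρ) (hτ : 0 ≤ τ)
    (hc : ∀ i : RectIdx d, |c i| ≤ τ * ρ ^ (i.2.1 + i.2.2 + 2)) (e : ZdEdge d)
    (pl : {p : Fin d × Fin d // p.1 < p.2}) (m n : ℕ) (Sx : Finset (Site d)) :
    ∑ x ∈ Sx, loopWeightAt w rectLoop c e ((x, pl), m, n) ≤ τ * (4 * ρ * exp w) ^ (m + n + 2) := by
  classical
  obtain ⟨S, hS, hmem⟩ := exists_bases_of_mem_walkEdges_rectWalk e pl.1.1 pl.1.2 (m + 1) (n + 1)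
  set g : ℝ := τ * (2 * ρ * exp w) ^ (m + n + 2) with hg
  have hg0 : 0 ≤ g := by positivity
  have hle : ∀ x ∈ Sx, loopWeightAt w rectLoop c e ((x, pl), m, n) ≤ if x ∈ S then g else 0 := by
    intro x _
    refine (loopWeightAt_rectLoop_le hw hρ hτ hc e ((x, pl), m, n)).trans ?_
    by_cases hx : e ∈ walkEdges (rectLoop ((x, pl), m, n)).walk
    · rw [if_pos hx, if_pos (hmem x hx)]
    · rw [if_neg hx]
      split_ifs
      · exact hg0
      · exact le_rfl
  refine (Finset.sum_le_sum hle).trans ?_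
  rw [Finset.sum_ite_mem, Finset.sum_const, nsmul_eq_mul]
  have hcard : (((Sx ∩ S).card : ℕ) : ℝ) ≤ 2 ^ (m + n + 2) := by
    have h1 : (Sx ∩ S).card ≤ 2 * (m + 1 + (n + 1)) := (Finset.card_le_card Finset.inter_subset_right).trans hS
    have h2 : ((2 * (m + 1 + (n + 1)) : ℕ) : ℝ) ≤ 2 ^ (m + n + 2) := by
      have := two_mul_le_two_pow (m + n + 2)
      push_cast at this ⊢
      linarith
    exact (Nat.cast_le.2 h1).trans h2
  calc (((Sx ∩ S).card : ℕ) : ℝ) * g ≤ 2 ^ (m + n + 2) * g := mul_le_mul_of_nonneg_right hcard hg0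
    _ = τ * (4 * ρ * exp w) ^ (m + n + 2) := by
        rw [hg, show (4 : ℝ) * ρ * exp w = 2 * (2 * ρ * exp w) by ring, mul_pow (2 : ℝ)]; ring

/-- **THE NORM OF RECTANGLE COUPLINGS**: if `|c_i| ≤ τ ρ^{R+T}` for every rectangle `i` (sides `R, T ≥ 1`) and
`s := 4ρe^{w} < 1` (`w, ρ, τ ≥ 0`), then `‖c‖_w ≤ P_d · τ · (s/(1−s))²`, `P_d` = the number of coordinate planes. -/
theorem loopNormLE_rectLoop (hw : 0 ≤ w) (hρ : 0 ≤ ρ) (hτ : 0 ≤ τ) (hs : 4 * ρ * exp w < 1)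
    (hc : ∀ i : RectIdx d, |c i| ≤ τ * ρ ^ (i.2.1 + i.2.2 + 2)) :
    LoopNormLE w rectLoop c
      (Fintype.card {p : Fin d × Fin d // p.1 < p.2} * τ * (4 * ρ * exp w / (1 - 4 * ρ * exp w)) ^ 2) := by
  classical
  set s := 4 * ρ * exp w with hsdef
  have hs0 : 0 ≤ s := by positivity
  set P : ℝ := ((Fintype.card {p : Fin d × Fin d // p.1 < p.2} : ℕ) : ℝ) with hP
  have hgeo := summable_geometric_of_lt_one hs0 hs
  have htsum := tsum_geometric_of_lt_one hs0 hs
  -- bounded partial sums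
  have hpartial : ∀ (e : ZdEdge d) (S : Finset (RectIdx d)),
      ∑ i ∈ S, loopWeightAt w rectLoop c e i ≤ P * τ * (s / (1 - s)) ^ 2 := by
    intro e S
    set X₁ := (S.image Prod.fst).image Prod.fst with hX₁
    set M := (S.image Prod.snd).image Prod.fst with hM
    set Nn := (S.image Prod.snd).image Prod.snd with hNn
    have hsub : S ⊆ (X₁ ×ˢ (Finset.univ : Finset {p : Fin d × Fin d // p.1 < p.2})) ×ˢ (M ×ˢ Nn) := by
      intro i hi
      simp only [Finset.mem_product, Finset.mem_univ, and_true, hX₁, hM, hNn, Finset.mem_image]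
      exact ⟨⟨i.1, ⟨i, hi, rfl⟩, rfl⟩, ⟨i.2, ⟨i, hi, rfl⟩, rfl⟩, ⟨i.2, ⟨i, hi, rfl⟩, rfl⟩⟩
    calc ∑ i ∈ S, loopWeightAt w rectLoop c e i
        ≤ ∑ i ∈ (X₁ ×ˢ (Finset.univ : Finset {p : Fin d × Fin d // p.1 < p.2})) ×ˢ (M ×ˢ Nn),
            loopWeightAt w rectLoop c e i :=
          Finset.sum_le_sum_of_subset_of_nonneg hsub fun i _ _ => loopWeightAt_nonneg _ _ _ _ _
      _ = ∑ q ∈ M ×ˢ Nn, ∑ pl : {p : Fin d × Fin d // p.1 < p.2}, ∑ x ∈ X₁,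
            loopWeightAt w rectLoop c e ((x, pl), q.1, q.2) := by
          rw [Finset.sum_product, Finset.sum_comm]
          refine Finset.sum_congr rfl fun q _ => ?_
          rw [Finset.sum_product, Finset.sum_comm]
      _ ≤ ∑ q ∈ M ×ˢ Nn, ∑ _pl : {p : Fin d × Fin d // p.1 < p.2}, τ * s ^ (q.1 + q.2 + 2) :=
          Finset.sum_le_sum fun q _ => Finset.sum_le_sum fun pl _ =>
            sum_loopWeightAt_rectLoop_le hw hρ hτ hc e pl q.1 q.2 X₁
      _ = P * τ * (s ^ 2 * ∑ q ∈ M ×ˢ Nn, s ^ q.1 * s ^ q.2) := by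
          simp only [Finset.sum_const, Finset.card_univ, nsmul_eq_mul, hP]
          rw [Finset.mul_sum, Finset.mul_sum]
          refine Finset.sum_congr rfl fun q _ => ?_
          ring
      _ = P * τ * (s ^ 2 * ((∑ m ∈ M, s ^ m) * ∑ n ∈ Nn, s ^ n)) := by
          rw [Finset.sum_product, Finset.sum_mul_sum]
      _ ≤ P * τ * (s ^ 2 * ((1 - s)⁻¹ * (1 - s)⁻¹)) := by
          have hM1 : ∑ m ∈ M, s ^ m ≤ (1 - s)⁻¹ := by
            rw [← htsum]; exact hgeo.sum_le_tsum M fun m _ => pow_nonneg hs0 m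
          have hN1 : ∑ n ∈ Nn, s ^ n ≤ (1 - s)⁻¹ := by
            rw [← htsum]; exact hgeo.sum_le_tsum Nn fun n _ => pow_nonneg hs0 n
          have hM0 : 0 ≤ ∑ m ∈ M, s ^ m := Finset.sum_nonneg fun m _ => pow_nonneg hs0 m
          have hPτ : 0 ≤ P * τ := by positivity
          exact mul_le_mul_of_nonneg_left (mul_le_mul_of_nonneg_left
            (mul_le_mul hM1 hN1 (Finset.sum_nonneg fun n _ => pow_nonneg hs0 n) (by positivity)) (sq_nonneg s)) hPτ
      _ = P * τ * (s / (1 - s)) ^ 2 := by rw [div_eq_mul_inv]; ring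
  refine ⟨by positivity, fun e => summable_of_sum_le (loopWeightAt_nonneg w rectLoop c e) (hpartial e),
    fun e => Real.tsum_le_of_sum_le (loopWeightAt_nonneg w rectLoop c e) (hpartial e)⟩

end Norm

/-! ### Cells -/

section Rows

/-- **`SU(2)`, `d = 4`, `β_W = 1/16` — ALL RECTANGLES AT ONCE, hypothesis-free**: the action
`S_Wilson + ∑_{x, a<b, R, T ≥ 1} c_{x,ab,R,T} · Re tr U_{∂(R×T at x in ab)} / 2` has a unique DLR state with
exponential clustering for EVERY coupling family with `|c_{x,ab,R,T}| ≤ 64^{-(R+T)}` (weight `2^{dist}`: norm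
`≤ 6/49 ≤ 0.143`, cell `su2_loopFamily_massGapS_1_16`). -/
theorem su2_rectFamily_massGapS_1_16 {c : RectIdx 4 → ℝ} (hc : ∀ i, |c i| ≤ (1 / 64 : ℝ) ^ (i.2.1 + i.2.2 + 2)) :
    PerturbedMassGapAtS 4 2 ((1 / 16 : ℝ) / 4) (loopFamilyAction (d := 4) 2 rectLoop c) := by
  have hq : exp (Real.log 2) = 2 := Real.exp_log (by norm_num)
  have h := loopNormLE_rectLoop (d := 4) (w := Real.log 2) (ρ := 1 / 64) (τ := 1) (c := c)
    (Real.log_nonneg (by norm_num)) (by norm_num) (by norm_num) (by rw [hq]; norm_num)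
    (fun i => by rw [one_mul]; exact hc i)
  have hP : Fintype.card {p : Fin 4 × Fin 4 // p.1 < p.2} = 6 := by decide
  rw [hq, hP] at h
  exact su2_loopFamily_massGapS_1_16 finite_fibre_rectLoop (h.mono (by norm_num))

/-- **Every `N ≥ 2`, `d = 4`, 't Hooft coupling `1/64` — all rectangles, hypothesis-free, `N`-uniform**: the mass gap
holds for EVERY coupling family with `|c_{x,ab,R,T}| ≤ ½ · 64^{-(R+T)}` (weight `(6/5)^{dist}`; cell
`suN_loopFamily_massGapS_1_64`). -/
theorem suN_rectFamily_massGapS_1_64 {N : ℕ} (hN : 2 ≤ N) {c : RectIdx 4 → ℝ}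
    (hc : ∀ i, |c i| ≤ 1 / 2 * (1 / 64 : ℝ) ^ (i.2.1 + i.2.2 + 2)) :
    PerturbedMassGapAtS 4 N (1 / 64) (loopFamilyAction (d := 4) N rectLoop c) := by
  have hq : exp (Real.log (6 / 5)) = 6 / 5 := Real.exp_log (by norm_num)
  have h := loopNormLE_rectLoop (d := 4) (w := Real.log (6 / 5)) (ρ := 1 / 64) (τ := 1 / 2) (c := c)
    (Real.log_nonneg (by norm_num)) (by norm_num) (by norm_num) (by rw [hq]; norm_num) hc
  have hP : Fintype.card {p : Fin 4 × Fin 4 // p.1 < p.2} = 6 := by decide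
  rw [hq, hP] at h
  exact suN_loopFamily_massGapS_1_64 hN finite_fibre_rectLoop (h.mono (by norm_num))

end Rows

/-! ### Infinite range: the family lies in no tier-1 ball -/

section Range

variable {N : ℕ}

/-- At `U ≡ 1` the loop-family action on the carrier of a rectangle is at least that rectangle's coupling
(nonnegative couplings). -/
theorem le_loopFamilyAction_rectLoop_one (hN : 1 ≤ N) {c : RectIdx d → ℝ} (hc : ∀ i, 0 ≤ c i) (i : RectIdx d) :
    c i ≤ loopFamilyAction N rectLoop c (walkEdges (rectLoop i).walk) (1 : LGConfig d (SUN N)) := by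
  classical
  unfold loopFamilyAction
  rw [indexedPotential_apply]
  simp_rw [loopTerm_one _ hN]
  exact Finset.single_le_sum (f := c) (fun j _ => hc j) ((mem_carrierFib finite_fibre_rectLoop _ _).2 rfl)

/-- **Infinite range**: for positive couplings and every `R₀`, some carrier holds a NONZERO term of the
rectangle-family action and two links at `ℓ^∞`-distance `> R₀` (a long thin rectangle; `d ≥ 2`, `N ≥ 1`). -/
theorem rectLoop_infiniteRange (hd : 2 ≤ d) (hN : 1 ≤ N) {c : RectIdx d → ℝ} (hc : ∀ i, 0 < c i) (R₀ : ℝ) :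
    ∃ (X : Finset (ZdEdge d)) (e y : ZdEdge d), e ∈ X ∧ y ∈ X ∧ R₀ < ‖e.1 - y.1‖ ∧
      loopFamilyAction (d := d) N rectLoop c X ≠ 0 := by
  set a : Fin d := ⟨0, by omega⟩ with ha
  set b : Fin d := ⟨1, by omega⟩ with hb
  have hab : a < b := by simp [ha, hb, Fin.lt_def]
  refine ⟨walkEdges (rectWalk (0 : Site d) a b (⌈R₀⌉₊ + 1) (0 + 1)), ((0 : Site d), a),
    ((0 : Site d) + Pi.single a (((⌈R₀⌉₊ + 1 : ℕ) : ℤ)) + Pi.single b ((0 : ℕ) : ℤ), b), ?_, ?_, ?_, fun h0 => ?_⟩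
  · rw [mem_walkEdges_rectWalk_iff]
    exact Or.inl ⟨0, Nat.succ_pos _, by simp⟩
  · rw [mem_walkEdges_rectWalk_iff]
    exact Or.inr (Or.inl ⟨0, Nat.succ_pos _, rfl⟩)
  · have hnorm : ‖(0 : Site d) - ((0 : Site d) + Pi.single a (((⌈R₀⌉₊ + 1 : ℕ) : ℤ)) + Pi.single b ((0 : ℕ) : ℤ))‖ =
        (⌈R₀⌉₊ : ℝ) + 1 := by
      rw [Nat.cast_zero, Pi.single_zero, add_zero, zero_add, zero_sub, norm_neg, Pi.norm_single, Int.norm_eq_abs]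
      push_cast
      exact abs_of_nonneg (by positivity)
    rw [hnorm]
    exact (Nat.le_ceil R₀).trans_lt (lt_add_one _)
  · set i : RectIdx d := (((0 : Site d), ⟨(a, b), hab⟩), ⌈R₀⌉₊, 0) with hi
    have h1 : c i ≤ loopFamilyAction N rectLoop c (walkEdges (rectWalk (0 : Site d) a b (⌈R₀⌉₊ + 1) (0 + 1)))
        (1 : LGConfig d (SUN N)) :=
      le_loopFamilyAction_rectLoop_one hN (fun j => (hc j).le) i
    rw [h0] at h1
    exact absurd h1 (not_le.2 (hc i))

/-- **The rectangle family lies in NO tier-1 ball**: for positive couplings (`d ≥ 2`, `N ≥ 1`) the action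
`loopFamilyAction N rectLoop c` is not a member of `MemBallZd ε₀ ε₁ R W supp` for any radii, range and support
family. -/
theorem not_memBallZd_rectFamily (hd : 2 ≤ d) (hN : 1 ≤ N) {c : RectIdx d → ℝ} (hc : ∀ i, 0 < c i)
    (ε₀ ε₁ R : ℝ) (supp : Finset (ZdEdge d) → Finset (Finset (ZdEdge d))) :
    ¬ MemBallZd ε₀ ε₁ R (loopFamilyAction (d := d) N rectLoop c) supp := by
  intro hW
  obtain ⟨X, e, y, he, hy, hR, hne⟩ := rectLoop_infiniteRange hd hN hc R
  have hX : X ∈ supp {e} := hW.supportedBy {e} X ⟨e, Finset.mem_inter.2 ⟨he, Finset.mem_singleton_self e⟩⟩ hne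
  exact absurd (hW.range e X hX he y hy) (not_le.2 hR)

end Range

end Summit.Ventures.YMGap.RobustBall

end
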